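import Summits.Ventures.PercRepro0.Invariance

/-! # F2 in Lean for EVERY lattice automorphism (p5)

FOUNDATIONS-p5 Theorem F2 in full generality: for a graph automorphism `g : lattice d ≃g lattice d` (translations,
and for `d = 2` the reflections, the coordinate swap and the rotations, as well as their composites), the induced
configuration map `autConfig g ω = { e : e.map g ∈ ω }` (i.e. `(T_g ω)(e) = ω(g e)`, the convention `T_{g⁻¹}` of the paper)
is a measurable bijection leaving `P_p` invariant (`P_map_autConfig`), transports open paths and clusters
(`conn_autConfig`, `connInf_autConfig`), and hence `τ_p(g x, g y) = τ_p(x, y)` and `P_p(g x ↔ ∞) = P_p(x ↔ ∞)`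
(`tau_aut`, `P_connInf_aut`). `Invariance.lean` is the special case of translations.
-/

namespace Summit.Ventures.PercRepro0.Defs

open MeasureTheory ProbabilityTheory unitInterval Set
open scoped ENNReal

variable {d : ℕ}

/-- The bijection of `Sym2 (Vertex d)` induced by a lattice automorphism. -/
def bondAut (g : lattice d ≃g lattice d) : Sym2 (Vertex d) ≃ Sym2 (Vertex d) where
  toFun := Sym2.map g
  invFun := Sym2.map g.symm
  left_inv := fun e => by simp [Sym2.map_map]
  right_inv := fun e => by simp [Sym2.map_map]

/-- `bondAut` on a pair. -/
theorem bondAut_pair (g : lattice d ≃g lattice d) (x y : Vertex d) :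
    bondAut g s(x, y) = s(g x, g y) := by
  simp [bondAut]

/-- A lattice automorphism preserves the bond set. -/
theorem bondAut_mem_bonds (g : lattice d ≃g lattice d) (e : Sym2 (Vertex d)) :
    bondAut g e ∈ bonds d ↔ e ∈ bonds d :=
  g.map_mem_edgeSet_iff

/-- The configuration map of a lattice automorphism: `e ∈ autConfig g ω ↔ e.map g ∈ ω`. -/
def autConfig (g : lattice d ≃g lattice d) (ω : Config d) : Config d := relabel (bondAut g) ω

/-- `autConfig g` is measurable. -/
theorem measurable_autConfig (g : lattice d ≃g lattice d) : Measurable (autConfig g) :=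
  measurable_relabel _

/-- F2(a) for every automorphism: `P_p` is invariant. -/
theorem P_map_autConfig (g : lattice d ≃g lattice d) (p : I) :
    (P d p).map (autConfig g) = P d p :=
  setBernoulli_map_relabel (bonds d) p (bondAut g) (bondAut_mem_bonds g)

/-- F2(a), event form: `P_p(T_g^{-1} A) = P_p(A)` for measurable `A`. -/
theorem P_autConfig_preimage (g : lattice d ≃g lattice d) (p : I) {A : Set (Config d)}
    (hA : MeasurableSet A) : P d p (autConfig g ⁻¹' A) = P d p A := by
  rw [← Measure.map_apply (measurable_autConfig g) hA, P_map_autConfig]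

/-- Adjacency in the open graph of a transported configuration. -/
theorem openGraph_autConfig_adj (g : lattice d ≃g lattice d) (ω : Config d) (x y : Vertex d) :
    (openGraph d (autConfig g ω)).Adj x y ↔ (openGraph d ω).Adj (g x) (g y) := by
  rw [openGraph, openGraph, SimpleGraph.fromEdgeSet_adj, SimpleGraph.fromEdgeSet_adj,
    Set.mem_inter_iff, Set.mem_inter_iff]
  have h1 : s(x, y) ∈ autConfig g ω ↔ s(g x, g y) ∈ ω := by
    show bondAut g s(x, y) ∈ ω ↔ _
    rw [bondAut_pair]
  have h2 : s(x, y) ∈ bonds d ↔ s(g x, g y) ∈ bonds d := by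
    have h := (bondAut_mem_bonds g s(x, y)).symm
    rw [bondAut_pair] at h
    exact h
  have h3 : x ≠ y ↔ g x ≠ g y := by simp
  rw [h1, h2, h3]

/-- F2(b): an automorphism is an isomorphism between the open graphs of `autConfig g ω` and `ω`. -/
def openGraphAutIso (g : lattice d ≃g lattice d) (ω : Config d) :
    openGraph d (autConfig g ω) ≃g openGraph d ω where
  toEquiv := g.toEquiv
  map_rel_iff' := fun {x y} => (openGraph_autConfig_adj g ω x y).symm

/-- F2(b): connections are transported by automorphisms. -/
theorem conn_autConfig (g : lattice d ≃g lattice d) (ω : Config d) (x y : Vertex d) :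
    Conn d (autConfig g ω) x y ↔ Conn d ω (g x) (g y) :=
  (SimpleGraph.Iso.reachable_iff (φ := openGraphAutIso g ω)).symm

/-- F2(b): clusters are transported by automorphisms. -/
theorem cluster_autConfig (g : lattice d ≃g lattice d) (ω : Config d) (x : Vertex d) :
    cluster d (autConfig g ω) x = g ⁻¹' cluster d ω (g x) := by
  ext y
  exact conn_autConfig g ω x y

/-- F2(b): `x ↔ ∞` is transported by automorphisms. -/
theorem connInf_autConfig (g : lattice d ≃g lattice d) (ω : Config d) (x : Vertex d) :
    ConnInf d (autConfig g ω) x ↔ ConnInf d ω (g x) := by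
  unfold ConnInf
  rw [cluster_autConfig]
  constructor
  · intro h
    exact ((Set.infinite_image_iff g.injective.injOn).2 h).mono (Set.image_preimage_subset _ _)
  · intro h
    exact h.preimage fun y _ => ⟨g.symm y, g.apply_symm_apply y⟩

/-- `{g x ↔ g y}` is the transport of `{x ↔ y}`. -/
theorem preimage_autConfig_conn (g : lattice d ≃g lattice d) (x y : Vertex d) :
    autConfig g ⁻¹' {ω : Config d | Conn d ω x y} = {ω : Config d | Conn d ω (g x) (g y)} := by
  ext ω
  exact conn_autConfig g ω x y

/-- `{g x ↔ ∞}` is the transport of `{x ↔ ∞}`. -/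
theorem preimage_autConfig_connInf (g : lattice d ≃g lattice d) (x : Vertex d) :
    autConfig g ⁻¹' {ω : Config d | ConnInf d ω x} = {ω : Config d | ConnInf d ω (g x)} := by
  ext ω
  exact connInf_autConfig g ω x

/-- F2(c): the two-point function is invariant under every lattice automorphism. -/
theorem tau_aut (g : lattice d ≃g lattice d) (p : I) (x y : Vertex d) :
    tau d p (g x) (g y) = tau d p x y := by
  unfold tau
  rw [← preimage_autConfig_conn g x y, P_autConfig_preimage g p (measurableSet_conn x y)]

/-- F2(c): `P_p(g x ↔ ∞) = P_p(x ↔ ∞)` for every lattice automorphism. -/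
theorem P_connInf_aut (g : lattice d ≃g lattice d) (p : I) (x : Vertex d) :
    P d p {ω : Config d | ConnInf d ω (g x)} = P d p {ω : Config d | ConnInf d ω x} := by
  rw [← preimage_autConfig_connInf g x, P_autConfig_preimage g p (measurableSet_connInf x)]

/-- F2(c): for every measurable event, `P_p(g A) = P_p(A)` (image form, `g A = { T_g ω : ω ∈ A }` with
`T_g = autConfig g⁻¹`, i.e. the image of `A` under `autConfig g.symm`). -/
theorem P_image_autConfig (g : lattice d ≃g lattice d) (p : I) {A : Set (Config d)}
    (hA : MeasurableSet A) : P d p (autConfig g.symm '' A) = P d p A := by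
  have hinv : ∀ ω : Config d, autConfig g (autConfig g.symm ω) = ω := by
    intro ω
    ext e
    show bondAut g.symm (bondAut g e) ∈ ω ↔ e ∈ ω
    have : bondAut g.symm (bondAut g e) = e := by
      induction e using Sym2.ind with
      | h x y => rw [bondAut_pair, bondAut_pair]; simp
    rw [this]
  have hinv' : ∀ ω : Config d, autConfig g.symm (autConfig g ω) = ω := by
    intro ω
    ext e
    show bondAut g (bondAut g.symm e) ∈ ω ↔ e ∈ ω
    have : bondAut g (bondAut g.symm e) = e := by
      induction e using Sym2.ind with
      | h x y => rw [bondAut_pair, bondAut_pair]; simp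
    rw [this]
  have himg : autConfig g.symm '' A = autConfig g ⁻¹' A := by
    ext ω
    constructor
    · rintro ⟨ω', hω', rfl⟩
      show autConfig g (autConfig g.symm ω') ∈ A
      rw [hinv]
      exact hω'
    · intro hω
      exact ⟨autConfig g ω, hω, hinv' ω⟩
  rw [himg, P_autConfig_preimage g p hA]

end Summit.Ventures.PercRepro0.Defs
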